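import Mathlib
import HarnessLib.Audit
import Summits.PneNP.PneNP.Theorems.PstarGateCaseTQuadFinal
import Summits.PneNP.PneNP.Theorems.PstarGateCasePNorFinal
import Summits.PneNP.PneNP.Theorems.PstarGateU2Final
import Summits.PneNP.PneNP.Theorems.PstarGateUnitCycleQuad
import Summits.PneNP.PneNP.Theorems.PstarGateUnitCycleAffine

/-!
# One GATED chord: the E2 count modulo its last open node N2X (prover-1 g20)

FRONTIER range-avoidance ladder, rung F-N3 (`stmt-PneNP-19007`), cell `pnp-ideate` (`PstarGateNodesX`); restricted-model proof complexity — nothing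
here bears on `P` versus `NP`.

Six of the seven closed-core one-gate nodes are theorems: N1X `gateCasePNorX_holds`, N3X `gateOrFamilyX_holds`, N4X `gateCaseTQuadX_holds`
(this seat), N5X `gateU2X_holds`, N6X `gateUnitCycleQuadX_holds`, N6′X `gateUnitCycleAffineX_holds`.  Plugging them into the coverage theorem
`PstarGateNodesX.gateCoverageX_holds` leaves the single open node N2X (`GateCasePUnitsX`: CASE P, at least one other chord, none (NOR)) as the
only hypothesis of the E2 count and of its raw form:

* `gateCountX_of_units` — **`GateCasePUnitsX → GateCountX`**;
* `cotree1Blind_of_units` — **`GateCasePUnitsX → TerminalFiveCotree1Blind`** (`cotree1Blind_of_gateCountX`).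
-/

set_option linter.dupNamespace false -- `Summit.PneNP.PneNP.…`: summit = sub-problem name (D-0017 single-conjunct layout)

open Summit.PneNP.PneNP.Theorems.PstarCoupled (TerminalFiveCotree1Blind)
open Summit.PneNP.PneNP.Theorems.PstarGateNodesX
open Summit.PneNP.PneNP.Theorems.PstarGateCasePNorFinal (gateCasePNorX_holds)
open Summit.PneNP.PneNP.Theorems.PstarGateOrFamilyFinal (gateOrFamilyX_holds)
open Summit.PneNP.PneNP.Theorems.PstarGateCaseTQuadFinal (gateCaseTQuadX_holds)
open Summit.PneNP.PneNP.Theorems.PstarGateU2Final (gateU2X_holds)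
open Summit.PneNP.PneNP.Theorems.PstarGateUnitCycleQuad (gateUnitCycleQuadX_holds)
open Summit.PneNP.PneNP.Theorems.PstarGateUnitCycleAffine (gateUnitCycleAffineX_holds)

namespace Summit.PneNP.PneNP.Theorems.PstarGateCountOfUnits

/-- **The E2 count modulo N2X.** -/
theorem gateCountX_of_units (h : GateCasePUnitsX) : GateCountX :=
  gateCoverageX_holds gateCasePNorX_holds h gateOrFamilyX_holds gateCaseTQuadX_holds gateU2X_holds gateUnitCycleQuadX_holds
    gateUnitCycleAffineX_holds

/-- **`TerminalFiveCotree1Blind` modulo N2X.** -/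
theorem cotree1Blind_of_units (h : GateCasePUnitsX) : TerminalFiveCotree1Blind :=
  cotree1Blind_of_gateCountX (gateCountX_of_units h)

end Summit.PneNP.PneNP.Theorems.PstarGateCountOfUnits
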